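import Summits.BirchSwinnertonDyer.Rank1Residual.X9.IwasawaLowerBoundRankOne
import HarnessLib

/-!
# Class X9: route U2′ with a partner of analytic rank ONE — the `p`-part of BSD propagates along
# mod-`p` congruences from ANY certified pair of analytic rank `≤ 1` (cell `b2b-bsdres`, unit
# `b2b-bsdres-x9`, gen 10; continuation of `X9/IwasawaLowerBoundRankOne.lean`)

HONEST FRAMING (run/shared/lean/b2b/bsd-rank1-residual/, verbatim in every file): the goal of the
cell is to DELETE the COMBINATION-SHAPED residual classes of the Birch–Swinnerton-Dyer formula for
ALL analytic-rank `≤ 1` elliptic curves over `ℚ` — "full BSD formula for every rank `≤ 1` curve in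
class `C`" assembled STRICTLY from published theorems — so that the rank-`≤ 1` remainder becomes
exactly the CONSTRUCTION-SHAPED classes, which are TYPED (missing-input `Prop`s), NOT attempted.
This is not "finishing BSD". Theorems only; NO named fact is introduced; X9's label (typed) is not
changed; no pair is booked by this file (the lane books, the referee rules).

## The observation (our own work, hence `Summits/`)

Route U2′ of gen 5 (`Rank1Residual/X9MuInvariant.lean`, `X9.bsdp_of_bsdpPartner…`): if a curve `A`
congruent to `E` mod `p` (`A[p] ≅ E[p]` as Galois modules — certificate C1, e.g. the Kraus–Oesterlé
list) has ANALYTIC RANK 0, `BSD(A,p)` and one unit coefficient of `𝓛_MSD(A)`, then Mazur's main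
conjecture holds for `(A,p)` integrally with `μ = 0` (`mazurMainConjecture_with_mu_zero_of_bsdp`: the
exponent `k` of BCS 2025 Thm. 1.1.2 (a) is forced to `0` by the rank-0 chain), Greenberg–Vatsal 2000
Thm. (1.4) carries it to `(E,p)`, and the cell's glue gives `BSD(E,p)` in analytic rank `≤ 1`.
The partner had to have rank 0 because only the rank-0 chain was run with an exponent.  Gen 10's
rank-ONE chain with exponent (`padicValRat_shaAn_add_exponent_of_analyticRank_eq_one`:
`ord_p #Ш(A)_an + k = ord_p #Ш(A)` in analytic rank 1, Perrin-Riou–Schneider + Perrin-Riou 1987 +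
the Schneider certificate) removes that restriction:

* `mazurMainConjecture_with_mu_zero_of_bsdp_of_analyticRank_eq_one` — `A` of analytic rank 1,
  `p ≥ 5` good ordinary, `A[p]` irreducible, `BSD(A,p)`, one unit coefficient of `𝓛_MSD(A)` and the
  Schneider certificate for `A` ⟹ the integral main conjecture for `(A,p)` with `μ = 0` at every
  datum (the `E₁`-hypothesis shape of `GreenbergVatsal2000.thm14_mainConjecture_transfer_of_torsionIso`);
  `…_of_analyticRank_le_one` — both ranks (gen 5's rank 0 + this);
* `bsdp_of_bsdpPartner_of_partnerRank_le_one` — `BSD(E,p)` on class X9 (`r_an(E) ≤ 1`) from a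
  congruent partner `A` of analytic rank `≤ 1` with `BSD(A,p)` + certificates (C1; `μ(𝓛_p(A)) = 0`;
  Schneider for `A` if `r_an(A) = 1`; Schneider for `E` if `r_an(E) = 1`);
  `…_of_congruences…` (C1 as the Kraus–Oesterlé list), `…_of_conductor_lt…` (`BSD(A,p)` from
  Miller / Creutz–Miller for `N_A < 5000`, rank `≤ 1`), `missingInputAt_of_bsdpPartner_of_partnerRank_le_one`.

So at a good ordinary irreducible `p ≥ 5` the `p`-part of BSD PROPAGATES along mod-`p` congruences
between curves of analytic rank `≤ 1` in EITHER direction — every certified census pair (Cha index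
rows, Miller's `N < 5000` theorem, visibility rows, …) is a source for its whole congruence class, at
the cost of finite certificates.  Census use (HOME/b2b-bsdres-x9/X9-CENSUS-G10.md): the still-open
X9 pairs of Cremona's table with a certified partner in another isogeny class, several of which
have partners of rank 1 only (e.g. `351424bn1 @ 5 ← 351424bm1`, `110352s1 @ 5 ← 110352u1`).

## References

* [GreenbergVatsal2000] Invent. Math. 142 (2000), Thm. (1.4) (arXiv p. 5).
* [BurungaleCastellaSkinner2025] IMRN 2025 = arXiv:2405.00270v2, Thm. 1.1.2 (a) (p. 2).
* [BalakrishnanMullerStein2015] Math. Comp. 85 (2016), Thm. 1.7; [PerrinRiou1987] §1.4 Cor. 1.8.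
* [GreenbergLNM1716] LNM 1716 (1999), Thm. 4.1 (p. 102).
* [KrausOesterle1992] Math. Ann. 293 (1992), Prop. 4; [Miller2011LMS] Thm. 1.2, Def. 1.1;
  [CreutzMiller2012] Thm. 1.1.
-/

set_option autoImplicit false

noncomputable section

open scoped Classical MatrixGroups ModularForm

open CongruenceSubgroup WeierstrassCurve Literature.NumberTheory.EllipticCurves
  Literature.NumberTheory.EllipticCurves.ModularForms Literature.NumberTheory.EllipticCurves.Rank1Residual

namespace Summit.BirchSwinnertonDyer.Rank1Residual.X9

/-! ### The partner side in analytic rank one -/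

/-- **`BSD(A,p)` in analytic rank 1, plus one unit coefficient of `𝓛_MSD(A)` and the Schneider
certificate, give Mazur's main conjecture for `(A,p)` integrally with `μ = 0`.**  `A` globally
minimal, `p ≥ 5` good ordinary, `A[p]` irreducible, `r_an(A) = 1`, Miller's `BSDp A p` (`hbsd`), the
Schneider certificate for THE canonical `p`-adic height of `A` (`hSchA`), and the certificate `hcert`
(for every newform `f_A` at level `N_A` and `ϖ_A·Ω_A = Ω⁺_{f_A}`, some coefficient of `ϖ_A·L_p(f_A, α)`
is a `p`-adic unit).  PUBLISHED inputs: BCS 2025 Thm. 1.1.2 (a) (`hBCS`), the period unit (`h5`),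
Perrin-Riou–Schneider (`hS`), Perrin-Riou 1987 (`hPR`), GZK (`hGZK`).  Conclusion: the `E₁`-hypothesis
shape of Greenberg–Vatsal's Thm. (1.4).  Proof: BCS (a) gives `ι g = p^k·L_p(f_A, α)`; the rank-one
chain `padicValRat_shaAn_add_exponent_of_analyticRank_eq_one` and `BSDp A p` give `k = 0`; then
`ι(ϖ_A g) = ϖ_A·L_p` and the certificate is a unit coefficient of `ϖ_A g`.  Rank-one twin of gen 5's
`mazurMainConjecture_with_mu_zero_of_bsdp`. [cite: BurungaleCastellaSkinner2025, Thm. 1.1.2 (a) (p. 2 of arXiv:2405.00270v2)]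
[cite: BalakrishnanMullerStein2015, Thm. 1.7] [cite: PerrinRiou1987, §1.4 Cor. 1.8] [cite: Miller2011LMS, Def. 1.1] -/
theorem mazurMainConjecture_with_mu_zero_of_bsdp_of_analyticRank_eq_one
    (hBCS : burungale_castella_skinner_charIdeal_eq_padicLFunction)
    (h5 : realPeriodRat_eq_unit_mul_plusPeriod)
    (hS : Schneider1985_order_charGenerator) (hPR : perrinRiou_rankOne_leadingTerms)
    (hGZK : rank_eq_analyticRank_of_analyticRank_le_one)
    (A : WeierstrassCurve ℚ) [A.IsElliptic] [A.IsGloballyMinimal] (p : ℕ) [Fact p.Prime]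
    (hp : 5 ≤ p) (hgood : A.HasGoodReductionAtPrime p) (hord : ¬ (p : ℤ) ∣ A.frobeniusTrace p)
    (hirr : A.HasIrreducibleModPGaloisRep p) (hrA : A.analyticRank = 1) (hbsd : BSDp A p)
    (hSchA : ∀ Dh : PAdicHeightData A p, Dh.IsCanonical → SchneiderConjecture Dh)
    (hcert : ∀ [NeZero (A.conductorNorm ℤ)] (fA : CuspForm (Gamma0 (A.conductorNorm ℤ)) 2),
        IsNewformOf A fA → ∀ (ϖ : ℚ), (ϖ : ℝ) * A.realPeriodRat = plusPeriod fA →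
      ∃ n : ℕ, ‖PowerSeries.coeff n
        (PowerSeries.C (ϖ : ℚ_[p]) * padicLFunction fA (unitRoot A p : ℚ_[p]))‖ = 1) :
    ∀ (κ : ZpExtension ℚ p) (γ : Field.absoluteGaloisGroup ℚ),
        κ.IsCyclotomic → κ.IsTopGenerator γ → IsCyclotomicVariable p γ →
      ∀ [NeZero (A.conductorNorm ℤ)] (fA : CuspForm (Gamma0 (A.conductorNorm ℤ)) 2),
        IsNewformOf A fA → ∀ (ϖ : ℚ), (ϖ : ℝ) * A.realPeriodRat = plusPeriod fA →
      ∀ (D : A.SelmerDualData κ γ), D.IsTorsion ∧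
        ∃ g : IwasawaAlgebra p, D.charIdeal = Ideal.span {g} ∧
          GreenbergVatsal2000.HasUnitContent g ∧
          iwasawaToPowerSeries p g =
            PowerSeries.C (ϖ : ℚ_[p]) * padicLFunction fA (unitRoot A p : ℚ_[p]) := by
  intro κ γ hκ hγ hγ' _ fA hf ϖ hϖeq D
  haveI : Finite A.sha := (hGZK A (by omega)).2
  have hϖnorm : ‖(ϖ : ℚ_[p])‖ = 1 := norm_periodRatio_eq_one h5 A p hp hgood hirr fA hf ϖ hϖeq
  have hϖv : padicValRat p ϖ = 0 := padicValRat_periodRatio_eq_zero A p h5 hp hgood hirr fA hf ϖ hϖeq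
  obtain ⟨Dh, hDh, -⟩ := existsUnique_isCanonical_holds A p hp hgood hord
  -- BCS (a) and the rank-one chain with exponent `k`
  obtain ⟨hX, g, k, hchar, hιg⟩ := hBCS A p κ γ fA hp hgood hord hirr hκ hγ hγ' hf D
  obtain ⟨s, hsha, -, hval⟩ := padicValRat_shaAn_add_exponent_of_analyticRank_eq_one hS hPR hGZK A p
    hp hgood hord hrA hκ hγ hγ' hf ϖ hϖeq hϖv Dh hDh (hSchA Dh hDh) D hX g k hchar hιg
  -- the same identity without `k`, from `BSDp A p`
  obtain ⟨-, -, q', hsha', hvq'⟩ := hbsd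
  have hqq : q' = s := by exact_mod_cast hsha'.symm.trans hsha
  rw [hqq, padicValNat_card_addPrimaryComponent (A := A.sha) p] at hvq'
  simp only [WeierstrassCurve.shaOrder] at hval
  have hk : k = 0 := by linarith
  rw [hk, zpow_zero, map_one, one_mul] at hιg
  -- rescale by the unit `ϖ` and read off the unit content
  set c : ℤ_[p] := ⟨(ϖ : ℚ_[p]), hϖnorm.le⟩ with hc_def
  have hcu : IsUnit c := PadicInt.isUnit_iff.mpr hϖnorm
  have hι' : iwasawaToPowerSeries p (PowerSeries.C c * g) =
      PowerSeries.C (ϖ : ℚ_[p]) * padicLFunction fA (unitRoot A p : ℚ_[p]) := by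
    rw [map_mul, hιg, PowerSeries.map_C]
    rfl
  refine ⟨hX, PowerSeries.C c * g, ?_, hasUnitContent_of_map_eq _ _ hι' (hcert fA hf ϖ hϖeq), hι'⟩
  rw [hchar]
  exact (Ideal.span_singleton_mul_left_unit (hcu.map PowerSeries.C) g).symm

/-- **The partner side in analytic rank `≤ 1`**: gen 5's rank-0 theorem
`mazurMainConjecture_with_mu_zero_of_bsdp` (Greenberg Thm. 4.1 `hGr`, modularity `hmodL`) and the
rank-1 theorem above (Schneider's certificate `hSchA` asked only when `r_an(A) = 1`).
[cite: GreenbergLNM1716, Thm. 4.1 (p. 102)] [cite: BalakrishnanMullerStein2015, Thm. 1.7]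
[cite: BurungaleCastellaSkinner2025, Thm. 1.1.2 (a) (p. 2 of arXiv:2405.00270v2)] -/
theorem mazurMainConjecture_with_mu_zero_of_bsdp_of_analyticRank_le_one
    (hBCS : burungale_castella_skinner_charIdeal_eq_padicLFunction)
    (hGr : greenberg_charValue_rankZero) (h5 : realPeriodRat_eq_unit_mul_plusPeriod)
    (hS : Schneider1985_order_charGenerator) (hPR : perrinRiou_rankOne_leadingTerms)
    (hmodL : hasEntireLFunction_rat) (hGZK : rank_eq_analyticRank_of_analyticRank_le_one)
    (A : WeierstrassCurve ℚ) [A.IsElliptic] [A.IsGloballyMinimal] (p : ℕ) [Fact p.Prime]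
    (hp : 5 ≤ p) (hgood : A.HasGoodReductionAtPrime p) (hord : ¬ (p : ℤ) ∣ A.frobeniusTrace p)
    (hirr : A.HasIrreducibleModPGaloisRep p) (hrA : A.analyticRank ≤ 1) (hbsd : BSDp A p)
    (hSchA : A.analyticRank = 1 → ∀ Dh : PAdicHeightData A p, Dh.IsCanonical → SchneiderConjecture Dh)
    (hcert : ∀ [NeZero (A.conductorNorm ℤ)] (fA : CuspForm (Gamma0 (A.conductorNorm ℤ)) 2),
        IsNewformOf A fA → ∀ (ϖ : ℚ), (ϖ : ℝ) * A.realPeriodRat = plusPeriod fA →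
      ∃ n : ℕ, ‖PowerSeries.coeff n
        (PowerSeries.C (ϖ : ℚ_[p]) * padicLFunction fA (unitRoot A p : ℚ_[p]))‖ = 1) :
    ∀ (κ : ZpExtension ℚ p) (γ : Field.absoluteGaloisGroup ℚ),
        κ.IsCyclotomic → κ.IsTopGenerator γ → IsCyclotomicVariable p γ →
      ∀ [NeZero (A.conductorNorm ℤ)] (fA : CuspForm (Gamma0 (A.conductorNorm ℤ)) 2),
        IsNewformOf A fA → ∀ (ϖ : ℚ), (ϖ : ℝ) * A.realPeriodRat = plusPeriod fA →
      ∀ (D : A.SelmerDualData κ γ), D.IsTorsion ∧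
        ∃ g : IwasawaAlgebra p, D.charIdeal = Ideal.span {g} ∧
          GreenbergVatsal2000.HasUnitContent g ∧
          iwasawaToPowerSeries p g =
            PowerSeries.C (ϖ : ℚ_[p]) * padicLFunction fA (unitRoot A p : ℚ_[p]) := by
  rcases Nat.le_one_iff_eq_zero_or_eq_one.mp hrA with h0 | h1
  · exact mazurMainConjecture_with_mu_zero_of_bsdp hBCS hGr h5 hmodL hGZK A p hp hgood hord hirr h0
      hbsd hcert
  · exact mazurMainConjecture_with_mu_zero_of_bsdp_of_analyticRank_eq_one hBCS h5 hS hPR hGZK A p hp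
      hgood hord hirr h1 hbsd (hSchA h1) hcert

/-! ### Transfer to the X9 pair: route U2′ with a partner of analytic rank `≤ 1` -/

section BSDpPartner

variable (W A : WeierstrassCurve ℚ) [W.IsElliptic] [W.IsGloballyMinimal] [A.IsElliptic]
  [A.IsGloballyMinimal] (p : ℕ) [Fact p.Prime]

/-- **Route U2′ with a partner of analytic rank `≤ 1`, both ranks of the target.**  `BSD(E,p)` on
class X9 (`r_an(E) ≤ 1`) from a congruent partner `A`: good ordinary at `p`, `r_an(A) ≤ 1`,
`BSDp A p` (`hbsdA` — Miller's theorem for `N_A < 5000`, or any lane-certified pair), the certificate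
`hcertA` (a unit coefficient of `𝓛_MSD(A)`), Schneider's certificate for `A` when `r_an(A) = 1`
(`hSchA`), C1 (`hC1`: a `Γ_ℚ`-isomorphism `A[p] ≅ E[p]`), and Schneider's certificate for `E` when
`r_an(E) = 1` (`hC3`).  PUBLISHED binders `hBCS`, `hGr`, `h5`, `hGV` (Greenberg–Vatsal Thm. (1.4)),
`hS`, `hPR`, `hmodP`, `hmodL`, `hGZK`.  The irreducibility of `A[p]` is that of `E[p]` along C1.
Rank 0 of `E`: `GreenbergVatsal2000.pPartRankZero_of_thm14`; rank 1 of `E`: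
`GreenbergVatsal2000.mazurMainConjecture_of_thm14` + `Wuthrich2014.missingPPartAt_of_mainConjecture_of_rank_one`.
[cite: GreenbergVatsal2000, Thm. (1.4) (arXiv p. 5)] [cite: GreenbergLNM1716, Thm. 4.1 (p. 102)]
[cite: PerrinRiou1987, §1.4 Cor. 1.8] [cite: BalakrishnanMullerStein2015, Thm. 1.7] -/
theorem bsdp_of_bsdpPartner_of_partnerRank_le_one
    (hBCS : burungale_castella_skinner_charIdeal_eq_padicLFunction)
    (hGr : greenberg_charValue_rankZero) (h5 : realPeriodRat_eq_unit_mul_plusPeriod)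
    (hGV : GreenbergVatsal2000.thm14_mainConjecture_transfer_of_torsionIso)
    (hS : Schneider1985_order_charGenerator) (hPR : perrinRiou_rankOne_leadingTerms)
    (hmodP : nonempty_modularParametrizationData) (hmodL : hasEntireLFunction_rat)
    (hGZK : rank_eq_analyticRank_of_analyticRank_le_one)
    (hran : W.analyticRank ≤ 1) (hX9 : ClassX9 W p)
    (hgoodA : A.HasGoodReductionAtPrime p) (hordA : ¬ (p : ℤ) ∣ A.frobeniusTrace p)
    (hrA : A.analyticRank ≤ 1) (hbsdA : BSDp A p)
    (hSchA : A.analyticRank = 1 → ∀ Dh : PAdicHeightData A p, Dh.IsCanonical → SchneiderConjecture Dh)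
    (hcertA : ∀ [NeZero (A.conductorNorm ℤ)] (fA : CuspForm (Gamma0 (A.conductorNorm ℤ)) 2),
        IsNewformOf A fA → ∀ (ϖ : ℚ), (ϖ : ℝ) * A.realPeriodRat = plusPeriod fA →
      ∃ n : ℕ, ‖PowerSeries.coeff n
        (PowerSeries.C (ϖ : ℚ_[p]) * padicLFunction fA (unitRoot A p : ℚ_[p]))‖ = 1)
    (hC1 : ∃ e : geomTorsion A (p : ℤ) ≃+ geomTorsion W (p : ℤ),
      ∀ (σ : Field.absoluteGaloisGroup ℚ) (P : geomTorsion A (p : ℤ)), e (σ • P) = σ • e P)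
    (hC3 : W.analyticRank = 1 → ∀ Dh : PAdicHeightData W p, Dh.IsCanonical → SchneiderConjecture Dh) :
    BSDp W p := by
  obtain ⟨-, ⟨hgood, hord⟩, hp, hirr, -, -⟩ := id hX9
  have hp2 : p ≠ 2 := by omega
  obtain ⟨e, he⟩ := hC1
  have hirrA : A.HasIrreducibleModPGaloisRep p :=
    hasIrreducibleModPGaloisRep_of_torsionIso_symm e he hirr
  have h₁ := mazurMainConjecture_with_mu_zero_of_bsdp_of_analyticRank_le_one hBCS hGr h5 hS hPR hmodL
    hGZK A p hp hgoodA hordA hirrA hrA hbsdA hSchA hcertA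
  rcases Nat.le_one_iff_eq_zero_or_eq_one.mp hran with hr | hr
  · have hL1 : W.entireLFunction 1 ≠ 0 := (W.analyticRank_eq_zero_iff_holds (hmodL W)).1 hr
    exact bsdp_of_pPartRankZero W p hmodL hGZK hr
      (GreenbergVatsal2000.pPartRankZero_of_thm14 A W p hGV hmodP hGZK hp2 hgoodA hordA hgood hord
        ⟨e, he⟩ hirrA h₁ hL1 (hGr W p hp2 hgood hord))
  · exact Typed.bsdp_of_missingPPartAt W p hGZK hran
      (Wuthrich2014.missingPPartAt_of_mainConjecture_of_rank_one hS hPR hmodP hGZK W p hp hgood hord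
        hr (hC3 hr)
        (GreenbergVatsal2000.mazurMainConjecture_of_thm14 A W p hGV hp2 hgoodA hordA hgood hord ⟨e, he⟩
          hirrA h₁))

/-- **The typed X9 output at a certified pair of route U2′ (partner of analytic rank `≤ 1`).**
[cite: Miller2011LMS, Def. 1.1] [cite: GreenbergVatsal2000, Thm. (1.4) (arXiv p. 5)] -/
theorem missingInputAt_of_bsdpPartner_of_partnerRank_le_one
    (hBCS : burungale_castella_skinner_charIdeal_eq_padicLFunction)
    (hGr : greenberg_charValue_rankZero) (h5 : realPeriodRat_eq_unit_mul_plusPeriod)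
    (hGV : GreenbergVatsal2000.thm14_mainConjecture_transfer_of_torsionIso)
    (hS : Schneider1985_order_charGenerator) (hPR : perrinRiou_rankOne_leadingTerms)
    (hmodP : nonempty_modularParametrizationData) (hmodL : hasEntireLFunction_rat)
    (hGZK : rank_eq_analyticRank_of_analyticRank_le_one)
    (hran : W.analyticRank ≤ 1) (hX9 : ClassX9 W p)
    (hgoodA : A.HasGoodReductionAtPrime p) (hordA : ¬ (p : ℤ) ∣ A.frobeniusTrace p)
    (hrA : A.analyticRank ≤ 1) (hbsdA : BSDp A p)
    (hSchA : A.analyticRank = 1 → ∀ Dh : PAdicHeightData A p, Dh.IsCanonical → SchneiderConjecture Dh)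
    (hcertA : ∀ [NeZero (A.conductorNorm ℤ)] (fA : CuspForm (Gamma0 (A.conductorNorm ℤ)) 2),
        IsNewformOf A fA → ∀ (ϖ : ℚ), (ϖ : ℝ) * A.realPeriodRat = plusPeriod fA →
      ∃ n : ℕ, ‖PowerSeries.coeff n
        (PowerSeries.C (ϖ : ℚ_[p]) * padicLFunction fA (unitRoot A p : ℚ_[p]))‖ = 1)
    (hC1 : ∃ e : geomTorsion A (p : ℤ) ≃+ geomTorsion W (p : ℤ),
      ∀ (σ : Field.absoluteGaloisGroup ℚ) (P : geomTorsion A (p : ℤ)), e (σ • P) = σ • e P)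
    (hC3 : W.analyticRank = 1 → ∀ Dh : PAdicHeightData W p, Dh.IsCanonical → SchneiderConjecture Dh) :
    Typed.X9.MissingInputAt W p := by
  haveI : Finite W.sha := (hGZK W hran).2
  exact Typed.X9.missingInputAt_of_bsdp W p
    (bsdp_of_bsdpPartner_of_partnerRank_le_one W A p hBCS hGr h5 hGV hS hPR hmodP hmodL hGZK hran hX9
      hgoodA hordA hrA hbsdA hSchA hcertA hC1 hC3)

/-- **Route U2′ (partner of analytic rank `≤ 1`) with C1 as the Kraus–Oesterlé congruence list.**
[cite: KrausOesterle1992, Prop. 4] [cite: GreenbergVatsal2000, Thm. (1.4) (arXiv p. 5)] -/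
theorem bsdp_of_bsdpPartner_of_congruences_of_partnerRank_le_one
    (hKO : KrausOesterle1992.prop4_torsionIso_of_congruences)
    (hBCS : burungale_castella_skinner_charIdeal_eq_padicLFunction)
    (hGr : greenberg_charValue_rankZero) (h5 : realPeriodRat_eq_unit_mul_plusPeriod)
    (hGV : GreenbergVatsal2000.thm14_mainConjecture_transfer_of_torsionIso)
    (hS : Schneider1985_order_charGenerator) (hPR : perrinRiou_rankOne_leadingTerms)
    (hmodP : nonempty_modularParametrizationData) (hmodL : hasEntireLFunction_rat)
    (hGZK : rank_eq_analyticRank_of_analyticRank_le_one)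
    (hran : W.analyticRank ≤ 1) (hX9 : ClassX9 W p)
    (hgoodA : A.HasGoodReductionAtPrime p) (hordA : ¬ (p : ℤ) ∣ A.frobeniusTrace p)
    (hrA : A.analyticRank ≤ 1) (hbsdA : BSDp A p)
    (hSchA : A.analyticRank = 1 → ∀ Dh : PAdicHeightData A p, Dh.IsCanonical → SchneiderConjecture Dh)
    (hcertA : ∀ [NeZero (A.conductorNorm ℤ)] (fA : CuspForm (Gamma0 (A.conductorNorm ℤ)) 2),
        IsNewformOf A fA → ∀ (ϖ : ℚ), (ϖ : ℝ) * A.realPeriodRat = plusPeriod fA →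
      ∃ n : ℕ, ‖PowerSeries.coeff n
        (PowerSeries.C (ϖ : ℚ_[p]) * padicLFunction fA (unitRoot A p : ℚ_[p]))‖ = 1)
    (hcong : ∀ (ℓ : ℕ) [Fact ℓ.Prime],
      6 * ℓ < KrausOesterle1992.gammaZeroIndex (KrausOesterle1992.modulus W A) →
      (padicValNat ℓ (W.conductorNorm ℤ * A.conductorNorm ℤ) = 0 →
          (p : ℤ) ∣ W.frobeniusTrace ℓ - A.frobeniusTrace ℓ) ∧
        (padicValNat ℓ (W.conductorNorm ℤ * A.conductorNorm ℤ) = 1 →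
          (p : ℤ) ∣ W.frobeniusTrace ℓ * A.frobeniusTrace ℓ - (ℓ + 1)))
    (hC3 : W.analyticRank = 1 → ∀ Dh : PAdicHeightData W p, Dh.IsCanonical → SchneiderConjecture Dh) :
    BSDp W p := by
  obtain ⟨-, -, -, hirr, -, -⟩ := id hX9
  exact bsdp_of_bsdpPartner_of_partnerRank_le_one W A p hBCS hGr h5 hGV hS hPR hmodP hmodL hGZK hran
    hX9 hgoodA hordA hrA hbsdA hSchA hcertA
    (KrausOesterle1992.torsionIso_of_congruences hKO W A p hirr hcong) hC3

/-- **Route U2′ with a partner of analytic rank `≤ 1` and conductor `< 5000`: every binder a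
PUBLISHED fact or a FINITE certificate.**  `BSD(A,p)` from Miller 2011 / Creutz–Miller 2012
(`hMiller` = `bsdp_of_irreducible_of_conductor_lt`, valid for `r_an(A) ≤ 1`; `A[p]` irreducible along
C1); C1 as the Kraus–Oesterlé list.  FINITE certificates: `r_an(A) ≤ 1` (`hrA`), `N_A < 5000` (`hNA`),
`hcertA`, `hcong`, Schneider for `A` in rank 1 (`hSchA`), Schneider for `E` in rank 1 (`hC3`).
[cite: Miller2011LMS, Thm. 1.2] [cite: CreutzMiller2012, Thm. 1.1] [cite: KrausOesterle1992, Prop. 4]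
[cite: GreenbergVatsal2000, Thm. (1.4) (arXiv p. 5)] -/
theorem bsdp_of_bsdpPartner_of_conductor_lt_of_partnerRank_le_one
    (hKO : KrausOesterle1992.prop4_torsionIso_of_congruences)
    (hMiller : bsdp_of_irreducible_of_conductor_lt)
    (hBCS : burungale_castella_skinner_charIdeal_eq_padicLFunction)
    (hGr : greenberg_charValue_rankZero) (h5 : realPeriodRat_eq_unit_mul_plusPeriod)
    (hGV : GreenbergVatsal2000.thm14_mainConjecture_transfer_of_torsionIso)
    (hS : Schneider1985_order_charGenerator) (hPR : perrinRiou_rankOne_leadingTerms)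
    (hmodP : nonempty_modularParametrizationData) (hmodL : hasEntireLFunction_rat)
    (hGZK : rank_eq_analyticRank_of_analyticRank_le_one)
    (hran : W.analyticRank ≤ 1) (hX9 : ClassX9 W p)
    (hgoodA : A.HasGoodReductionAtPrime p) (hordA : ¬ (p : ℤ) ∣ A.frobeniusTrace p)
    (hrA : A.analyticRank ≤ 1) (hNA : A.conductorNorm ℤ < 5000)
    (hSchA : A.analyticRank = 1 → ∀ Dh : PAdicHeightData A p, Dh.IsCanonical → SchneiderConjecture Dh)
    (hcertA : ∀ [NeZero (A.conductorNorm ℤ)] (fA : CuspForm (Gamma0 (A.conductorNorm ℤ)) 2),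
        IsNewformOf A fA → ∀ (ϖ : ℚ), (ϖ : ℝ) * A.realPeriodRat = plusPeriod fA →
      ∃ n : ℕ, ‖PowerSeries.coeff n
        (PowerSeries.C (ϖ : ℚ_[p]) * padicLFunction fA (unitRoot A p : ℚ_[p]))‖ = 1)
    (hcong : ∀ (ℓ : ℕ) [Fact ℓ.Prime],
      6 * ℓ < KrausOesterle1992.gammaZeroIndex (KrausOesterle1992.modulus W A) →
      (padicValNat ℓ (W.conductorNorm ℤ * A.conductorNorm ℤ) = 0 →
          (p : ℤ) ∣ W.frobeniusTrace ℓ - A.frobeniusTrace ℓ) ∧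
        (padicValNat ℓ (W.conductorNorm ℤ * A.conductorNorm ℤ) = 1 →
          (p : ℤ) ∣ W.frobeniusTrace ℓ * A.frobeniusTrace ℓ - (ℓ + 1)))
    (hC3 : W.analyticRank = 1 → ∀ Dh : PAdicHeightData W p, Dh.IsCanonical → SchneiderConjecture Dh) :
    BSDp W p := by
  obtain ⟨-, -, -, hirr, -, -⟩ := id hX9
  obtain ⟨e, he⟩ := KrausOesterle1992.torsionIso_of_congruences hKO W A p hirr hcong
  have hirrA : A.HasIrreducibleModPGaloisRep p :=
    hasIrreducibleModPGaloisRep_of_torsionIso_symm e he hirr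
  exact bsdp_of_bsdpPartner_of_partnerRank_le_one W A p hBCS hGr h5 hGV hS hPR hmodP hmodL hGZK hran
    hX9 hgoodA hordA hrA (hMiller A hrA hNA p Fact.out hirrA) hSchA hcertA ⟨e, he⟩ hC3

end BSDpPartner

end Summit.BirchSwinnertonDyer.Rank1Residual.X9

end
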